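import Summits.QuantumAdvantage.QuantumAdvantage.Theorems.CubicForrelationNearExactIsExactTwelvePartnerR2Blocks
import Summits.QuantumAdvantage.QuantumAdvantage.Theorems.CubicForrelationNearExactIsExactTwelvePartnerRadical

/-!
# Crux `CubicForrelation.NearExactIsExact` (stmt-QuantumAdvantage-14043) — n = 12, E1280-even, R2 leaf T⊕T′ ASSEMBLED
  (E1280-HANDPROOFS.md §1.7): frame data + light structure + pairing partner ⇒ contradiction, by a RADICAL vector

Certificate seat `b2b-cforr-cert` (gen 39).  HONEST FRAMING: kernel-checked (standard axioms) end-to-end version of the leaf T⊕T′ in the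
coefficient-tensor language.  Cell coordinates `Fin 9 = Fin (6 + 3)`: the descendant `t̄ = T⊕T′` lives on the first six, `R₃ = Rad t̄ =
{s₆,s₇,s₈}` (`Fin.natAdd 6 r`).  Frame data: `hF1`; `htbR` (no monomial of `t̄` through `R₃`); light structure (g36 L3): the alternating
parts, hence `G` and `Γ`, vanish on `R₃`-rows (`hGR`, `hΓR`).  The shear term `m_s = d_{y₂y₃σ_s}` is NOT assumed zero: the slice of `d` at
`σ_r` (`r ∈ R₃`) is `m_r · y₂∧y₃`, so a non-zero `u ∈ R₃` with `Σ u_r m_r = 0` (it exists among `e₆, e₇, e₆+e₇`) is a radical vector of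
`d`, contradicting `tpr_radical_obstruction`.  NOT summit progress.
-/

set_option linter.dupNamespace false -- D-0017: single-problem summit ⇒ `QuantumAdvantage.QuantumAdvantage` by design

namespace Summit.QuantumAdvantage.QuantumAdvantage.Theorems.CubicForrelation.NearExactIsExact

open Finset Matrix

/-- **R2 leaf T⊕T′, assembled.** [this work] -/
theorem tpa_R2_TT (c d : Fin (3 + 9) → Fin (3 + 9) → Fin (3 + 9) → ZMod 2)
    (hds : ∀ φ j k, d φ k j = d φ j k) (hdc : ∀ φ j k, d j φ k = d φ j k) (hdd : ∀ φ j, d φ j j = 0)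
    (hpair : ∀ p φ, (∑ j, ∑ k, (if j < k then c p j k * d φ j k else 0)) = if p = φ then 1 else 0)
    (hF1 : ∀ j k, d (Fin.castAdd 9 0) j k =
      if (j = Fin.castAdd 9 1 ∧ k = Fin.castAdd 9 2) ∨ (j = Fin.castAdd 9 2 ∧ k = Fin.castAdd 9 1) then 1 else 0)
    (htbR : ∀ (r : Fin 3) (s t : Fin (6 + 3)), d (Fin.natAdd 3 (Fin.natAdd 6 r)) (Fin.natAdd 3 s) (Fin.natAdd 3 t) = 0)
    (hGR : ∀ (r : Fin 3) (s : Fin (6 + 3)), d (Fin.castAdd 9 1) (Fin.natAdd 3 (Fin.natAdd 6 r)) (Fin.natAdd 3 s) = 0)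
    (hΓR : ∀ (r : Fin 3) (s : Fin (6 + 3)), d (Fin.castAdd 9 2) (Fin.natAdd 3 (Fin.natAdd 6 r)) (Fin.natAdd 3 s) = 0) : False := by
  obtain ⟨-, -, -, -, -, ds0k, dsf12, -, dsf1s, dsf2s, -, -⟩ := tpb_d_vals d hds hdc hF1
  set m : Fin 3 → ZMod 2 := fun r => d (Fin.castAdd 9 1) (Fin.castAdd 9 2) (Fin.natAdd 3 (Fin.natAdd 6 r)) with hm
  -- the slice of `d` at `σ_r`, `r ∈ R₃`, is `m_r · (y₂ ∧ y₃)`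
  have hslice : ∀ (r : Fin 3) (j k : Fin (3 + 9)), d (Fin.natAdd 3 (Fin.natAdd 6 r)) j k =
      m r * (if (j = Fin.castAdd 9 1 ∧ k = Fin.castAdd 9 2) ∨ (j = Fin.castAdd 9 2 ∧ k = Fin.castAdd 9 1) then 1 else 0) := by
    intro r j k
    have ne12 : (Fin.castAdd 9 1 : Fin (3 + 9)) ≠ Fin.castAdd 9 2 := by decide
    have nes : ∀ (s : Fin 9) (a : Fin 3), (Fin.natAdd 3 s : Fin (3 + 9)) ≠ Fin.castAdd 9 a := fun s a h => by
      have := congrArg Fin.val h; simp only [Fin.val_natAdd, Fin.val_castAdd] at this; omega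
    induction j using Fin.addCases with
    | left a =>
      induction k using Fin.addCases with
      | left b =>
        fin_cases a <;> fin_cases b
        · rw [if_neg (by decide), mul_zero]; exact hdd _ _
        · rw [if_neg (by decide), mul_zero]; exact ds0k _ _
        · rw [if_neg (by decide), mul_zero]; exact ds0k _ _
        · rw [if_neg (by decide), mul_zero, hds]; exact ds0k _ _
        · rw [if_neg (by decide), mul_zero]; exact hdd _ _
        · rw [if_pos (by decide), mul_one]; exact dsf12 _
        · rw [if_neg (by decide), mul_zero, hds]; exact ds0k _ _
        · rw [if_pos (by decide), mul_one, hds]; exact dsf12 _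
        · rw [if_neg (by decide), mul_zero]; exact hdd _ _
      | right s =>
        rw [if_neg (by rintro (⟨-, h⟩ | ⟨-, h⟩) <;> exact nes s _ h), mul_zero]
        fin_cases a
        · exact ds0k _ _
        · show d _ (Fin.castAdd 9 1) _ = 0
          rw [dsf1s]; exact hGR r s
        · show d _ (Fin.castAdd 9 2) _ = 0
          rw [dsf2s]; exact hΓR r s
    | right s =>
      rw [if_neg (by rintro (⟨h, -⟩ | ⟨h, -⟩) <;> exact nes s _ h), mul_zero]
      induction k using Fin.addCases with
      | left b =>
        rw [hds]
        fin_cases b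
        · exact ds0k _ _
        · show d _ (Fin.castAdd 9 1) _ = 0
          rw [dsf1s]; exact hGR r s
        · show d _ (Fin.castAdd 9 2) _ = 0
          rw [dsf2s]; exact hΓR r s
      | right t => exact htbR r s t
  -- a non-zero `u ∈ R₃` with `Σ u_r m_r = 0`
  obtain ⟨lam, hlne, hlm⟩ : ∃ lam : Fin 3 → ZMod 2, lam ≠ 0 ∧ (∑ r, lam r * m r) = 0 := by
    have h01 : ∀ x : ZMod 2, x = 0 ∨ x = 1 := by decide
    rcases h01 (m 0) with h0 | h0
    · refine ⟨![1, 0, 0], by decide, ?_⟩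
      rw [Fin.sum_univ_three]; simp [h0]
    · rcases h01 (m 1) with h1 | h1
      · refine ⟨![0, 1, 0], by decide, ?_⟩
        rw [Fin.sum_univ_three]; simp [h1]
      · refine ⟨![1, 1, 0], by decide, ?_⟩
        rw [Fin.sum_univ_three]; simp [h0, h1]; decide
  set u : Fin (3 + 9) → ZMod 2 := fun φ => ∑ r, lam r * (if φ = Fin.natAdd 3 (Fin.natAdd 6 r) then 1 else 0) with hu
  have hrad : ∀ j k, (∑ φ, u φ * d φ j k) = 0 := by
    intro j k
    have hterm : ∀ φ, u φ * d φ j k = ∑ r, lam r * ((if φ = Fin.natAdd 3 (Fin.natAdd 6 r) then 1 else 0) * d φ j k) := by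
      intro φ; rw [hu, Finset.sum_mul]; exact Finset.sum_congr rfl fun r _ => by ring
    rw [Finset.sum_congr rfl fun φ _ => hterm φ, Finset.sum_comm]
    have hinner : ∀ r, (∑ φ, lam r * ((if φ = Fin.natAdd 3 (Fin.natAdd 6 r) then 1 else 0) * d φ j k)) =
        lam r * m r * (if (j = Fin.castAdd 9 1 ∧ k = Fin.castAdd 9 2) ∨ (j = Fin.castAdd 9 2 ∧ k = Fin.castAdd 9 1) then 1 else 0) := by
      intro r
      rw [← Finset.mul_sum, Finset.sum_eq_single (Fin.natAdd 3 (Fin.natAdd 6 r))]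
      · rw [if_pos rfl, one_mul, hslice, mul_assoc]
      · intro φ _ hφ; rw [if_neg hφ, zero_mul]
      · intro h0; exact absurd (Finset.mem_univ _) h0
    rw [Finset.sum_congr rfl fun r _ => hinner r, ← Finset.sum_mul]
    rw [show (∑ r, lam r * m r) = 0 from hlm, zero_mul]
  have hzero := tpr_radical_obstruction c d hpair u hrad
  apply hlne
  funext r
  have := congrFun hzero (Fin.natAdd 3 (Fin.natAdd 6 r))
  rw [hu] at this
  simp only [Pi.zero_apply] at this
  rw [Finset.sum_eq_single r] at this
  · simpa using this
  · intro r' _ hr'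
    rw [if_neg, mul_zero]
    intro h
    have := congrArg Fin.val h; simp only [Fin.val_natAdd] at this
    exact hr' (Fin.ext (by omega)).symm
  · intro h0; exact absurd (Finset.mem_univ _) h0

end Summit.QuantumAdvantage.QuantumAdvantage.Theorems.CubicForrelation.NearExactIsExact
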